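import Summits.ResolutionOfSingularities.ResolutionOfSingularities.Theorems.DescentPerfectToAll.Negative.WoundInheritance

/-!
# `DescentPerfectToAll` — the wound criterion: `Y ×ₖ k(a^{1/p})` is regular iff `Y` is regular and unwounded

Support lemma for crux `stmt-ResolutionOfSingularities-0549`
(`Summit.ResolutionOfSingularities.ResolutionOfSingularities.Theses.Descent.DescentPerfectToAll`);
OURS, companion of `WoundInheritance.lean` (same directory), which proved the negative half. Here
the local description is recorded as an ISOMORPHISM and the Kummer criterion
(`stub_kummerCriterion`, p104053) is transported in BOTH directions, giving the certificate an
UP-strategy (raise the ground field by one `p`-th root of a constant, STRATEGY-CENSUS §2) must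
produce at each raise.

Setting: `k` of characteristic `p`, `K = k(α)`, `α^p = a ∉ k^p`; a point `y` of a `k`-scheme is
WOUNDED if `a ≡ c^p (mod 𝔪_y²)` for some `c ∈ 𝒪_{Y,y}` (`a` read in `𝒪_{Y,y}` through the
structure morphism).

* `nonempty_ringEquiv_localization_baseChange` — for a `k`-algebra `B`, a prime `𝔓` of `B ⊗ₖ K`
  over `𝔭`, and any localisation `O` of `B` at `𝔭`: `(B ⊗ₖ K)_𝔓 ≅ O[X]/(X^p - a)`.
* `isRegularLocalRing_localization_baseChange_iff` — with `O` regular: `(B ⊗ₖ K)_𝔓` is regular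
  iff `𝔭` is unwounded (`∀ c, a - c^p ∉ 𝔪_O²`).
* `isRegular_pullback_iff_forall_not_wound` — **for a regular `k`-scheme `Y`, `Y ×_{Spec k} Spec K`
  is regular iff no point of `Y` is wounded** (one-root instance of STRATEGY-CENSUS §2.2 (ii):
  "for `X_m` regular at `x_m`, `X_k` is regular at `x'` iff `E_m(x') = 0`").
* `isRegular_pullback_of_forall_residue` — the trivially unwounded case: if `a` is not congruent
  to a `p`-th power modulo `𝔪_y` at any point (inert residue fields), `Y ×ₖ K` is regular.

Nothing here bears on the crux or the summit as stated (mechanism-level tool). Sources: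
Cruxes/DescentPerfectToAll/STRATEGY-CENSUS.md §2.2–§2.4 (this tree); H. Matsumura, Commutative Ring
Theory, CUP 1986, Thm. 14.2 (via the Kummer criterion file).
-/

noncomputable section

open CategoryTheory CategoryTheory.Limits AlgebraicGeometry TopologicalSpace
open Polynomial TensorProduct IsLocalRing
open Literature.AlgebraicGeometry.Resolution

set_option linter.dupNamespace false -- mandated namespace `…ResolutionOfSingularities.ResolutionOfSingularities…` of this single-conjunct summit

namespace Summit.ResolutionOfSingularities.ResolutionOfSingularities.Theorems.DescentPerfectToAll.Negative

/-! ## §1 The local rings of `B ⊗ₖ K` -/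

section Localization

variable {k K : Type} [Field k] [Field K] [Algebra k K] {p : ℕ} [Fact p.Prime]
variable {B : Type} [CommRing B] [Algebra k B]

/-- **The local rings of a one-root base change.** For `K = k(α)`, `α^p = a ∉ k^p`, a
`k`-algebra `B`, a prime `𝔓` of `B ⊗ₖ K` over `𝔭 ⊂ B`, and any localisation `O` of `B` at `𝔭`
(compatibly a `k`-algebra): `(B ⊗ₖ K)_𝔓 ≅ O[X]/(X^p - a)`. (`(B ⊗ₖ K)_𝔓` is the localisation
of `(B ∖ 𝔭)⁻¹(B ⊗ₖ K) ≅ O ⊗ₖ K ≅ O[X]/(X^p - a)` at elements which are already units there: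
`s ∉ 𝔓 ⇒ s^p ∈ (B ∖ 𝔭) ⊗ 1`.) [folklore] -/
theorem nonempty_ringEquiv_localization_baseChange [CharP k p] {a : k} {α : K}
    (ha : ∀ b : k, b ^ p ≠ a) (hα : α ^ p = algebraMap k K a)
    (hgen : IntermediateField.adjoin k {α} = ⊤) (𝔭 : Ideal B) [𝔭.IsPrime]
    (O : Type) [CommRing O] [Algebra B O] [Algebra k O] [IsScalarTower k B O]
    [IsLocalization.AtPrime O 𝔭]
    (𝔓 : Ideal (B ⊗[k] K)) [𝔓.IsPrime] (h𝔓 : 𝔓.comap (algebraMap B (B ⊗[k] K)) = 𝔭) :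
    Nonempty (Localization.AtPrime 𝔓 ≃+* AdjoinRoot (X ^ p - C (algebraMap k O a) : O[X])) := by
  have hp : p.Prime := Fact.out
  haveI : Nontrivial (B ⊗[k] K) := by
    by_contra h
    rw [not_nontrivial_iff_subsingleton] at h
    exact Ideal.IsPrime.ne_top' (Subsingleton.elim 𝔓 ⊤)
  haveI : CharP (B ⊗[k] K) p :=
    charP_of_injective_algebraMap (algebraMap k (B ⊗[k] K)).injective p
  set M : Submonoid B := 𝔭.primeCompl with hM
  set M' : Submonoid (B ⊗[k] K) := Algebra.algebraMapSubmonoid (B ⊗[k] K) M with hM'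
  have hle : M' ≤ 𝔓.primeCompl := by
    rintro _ ⟨b, hb, rfl⟩
    intro hb'
    apply hb
    show b ∈ 𝔭
    rw [← h𝔓, Ideal.mem_comap]
    exact hb'
  set S := Localization M' with hS
  set T := Localization.AtPrime 𝔓 with hT
  letI : Algebra S T := IsLocalization.localizationAlgebraOfSubmonoidLe S T M' 𝔓.primeCompl hle
  haveI : IsScalarTower (B ⊗[k] K) S T :=
    IsLocalization.localization_isScalarTower_of_submonoid_le S T M' 𝔓.primeCompl hle
  haveI hTS : IsLocalization (𝔓.primeCompl.map (algebraMap (B ⊗[k] K) S)) T :=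
    IsLocalization.isLocalization_of_submonoid_le S T M' 𝔓.primeCompl hle
  have hunits : 𝔓.primeCompl.map (algebraMap (B ⊗[k] K) S) ≤ IsUnit.submonoid S := by
    rintro _ ⟨s, hs, rfl⟩
    obtain ⟨b, hb⟩ := exists_pow_eq_tmul_one B hα hgen s
    have hbM : b ∈ M := by
      intro hb𝔭
      apply hs
      have h1 : s ^ p ∈ 𝔓 := by
        rw [hb]
        have : b ∈ 𝔓.comap (algebraMap B (B ⊗[k] K)) := by rw [h𝔓]; exact hb𝔭
        exact this
      exact Ideal.IsPrime.mem_of_pow_mem inferInstance p h1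
    have hmem : (b ⊗ₜ[k] (1 : K)) ∈ M' := ⟨b, hbM, rfl⟩
    have hu : IsUnit (algebraMap (B ⊗[k] K) S (b ⊗ₜ[k] 1)) :=
      IsLocalization.map_units S (⟨b ⊗ₜ[k] 1, hmem⟩ : M')
    rw [← hb, map_pow] at hu
    exact (isUnit_pow_iff hp.ne_zero).mp hu
  let eST : S ≃ₐ[S] T :=
    IsLocalization.atUnits S (𝔓.primeCompl.map (algebraMap (B ⊗[k] K) S)) hunits
  let e₁ : S ≃ₐ[B ⊗[k] K] (B ⊗[k] K) ⊗[B] O :=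
    IsLocalization.algEquiv M' S ((B ⊗[k] K) ⊗[B] O)
  let e₂ : (B ⊗[k] K) ⊗[B] O ≃ₐ[B] O ⊗[B] (B ⊗[k] K) := Algebra.TensorProduct.comm B (B ⊗[k] K) O
  let e₃ : O ⊗[B] (B ⊗[k] K) ≃ₐ[O] O ⊗[k] K := Algebra.TensorProduct.cancelBaseChange k B O O K
  obtain ⟨e₄⟩ := nonempty_baseChangeRootAlgEquiv O ha hα hgen
  exact ⟨eST.symm.toRingEquiv.trans (e₁.toRingEquiv.trans (e₂.toRingEquiv.trans
    (e₃.toRingEquiv.trans e₄.toRingEquiv)))⟩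

/-- **The local Kummer criterion for a one-root base change.** In the situation of
`nonempty_ringEquiv_localization_baseChange` with `O = B_𝔭` a regular local ring:
`(B ⊗ₖ K)_𝔓` is regular iff `𝔭` is UNWOUNDED for the root `a^{1/p}` (`a - c^p ∉ 𝔪_O²` for all
`c ∈ O`). (The ring isomorphism above and `stub_kummerCriterion`, p104053.) [folklore] -/
theorem isRegularLocalRing_localization_baseChange_iff [CharP k p] {a : k} {α : K}
    (ha : ∀ b : k, b ^ p ≠ a) (hα : α ^ p = algebraMap k K a)
    (hgen : IntermediateField.adjoin k {α} = ⊤) (𝔭 : Ideal B) [𝔭.IsPrime]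
    (O : Type) [CommRing O] [Algebra B O] [Algebra k O] [IsScalarTower k B O]
    [IsLocalization.AtPrime O 𝔭] [IsRegularLocalRing O]
    (𝔓 : Ideal (B ⊗[k] K)) [𝔓.IsPrime] (h𝔓 : 𝔓.comap (algebraMap B (B ⊗[k] K)) = 𝔭) :
    IsRegularLocalRing (Localization.AtPrime 𝔓) ↔
      ∀ c : O, algebraMap k O a - c ^ p ∉ (maximalIdeal O) ^ 2 := by
  haveI : CharP O p := charP_of_injective_algebraMap (algebraMap k O).injective p
  obtain ⟨e⟩ := nonempty_ringEquiv_localization_baseChange ha hα hgen 𝔭 O 𝔓 h𝔓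
  rw [← stub_kummerCriterion p O (algebraMap k O a)]
  exact ⟨fun h => by haveI := h; exact IsRegularLocalRing.of_ringEquiv e,
    fun h => by haveI := h; exact IsRegularLocalRing.of_ringEquiv e.symm⟩

end Localization

/-! ## §2 Scheme form: the wound criterion -/

section SchemeLevel

variable {k K : Type} [Field k] [Field K] [Algebra k K] {p : ℕ} [Fact p.Prime] [CharP k p]

/-- **The wound criterion.** Let `K = k(α)`, `α^p = a ∉ k^p`, and let `q : Y → Spec k` be a
REGULAR `k`-scheme. Then `Y ×_{Spec k} Spec K` is regular iff `Y` has NO wounded point for the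
root `a^{1/p}`: at every `y ∈ Y` and for every `c ∈ 𝒪_{Y,y}`, the constant `a` (read in `𝒪_{Y,y}`
through `q`) satisfies `a - c^p ∉ 𝔪_y²`. (`⟹`: `not_isRegular_pullback_of_wound`; `⟸`: every
point of the base change lies in a chart `Spec (Γ(Y, W) ⊗ₖ K)` over an affine open `W` of `Y`,
where `isRegularLocalRing_localization_baseChange_iff` applies at the point of `W` under it.)
This is the one-root instance of STRATEGY-CENSUS §2.2 (ii) («for `X_m` regular at `x_m`: `X_k`
is regular at `x'` iff `E_m(x') = 0`»), the certificate an UP-strategy has to produce at each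
raise of the ground field. [folklore] -/
theorem isRegular_pullback_iff_forall_not_wound {a : k} {α : K} (ha : ∀ b : k, b ^ p ≠ a)
    (hα : α ^ p = algebraMap k K a) (hgen : IntermediateField.adjoin k {α} = ⊤)
    {Y : Scheme.{0}} (q : Y ⟶ Spec (.of k)) (hY : Scheme.IsRegular Y) :
    Scheme.IsRegular (pullback q (Spec.map (CommRingCat.ofHom (algebraMap k K)))) ↔
      ∀ (y : Y) (c : Y.presheaf.stalk y),
        (Y.presheaf.germ ⊤ y trivial).hom (q.appTop.hom ((Scheme.ΓSpecIso (.of k)).inv.hom a)) -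
          c ^ p ∉ (maximalIdeal (Y.presheaf.stalk y)) ^ 2 := by
  have hp : p.Prime := Fact.out
  constructor
  · intro hreg y c hc
    exact not_isRegular_pullback_of_wound ha hα hgen q y (hY y) ⟨c, hc⟩ hreg
  intro hun z
  -- an affine chart `W ∋ fst z`, with its `k`-algebra structure read through `q`
  obtain ⟨W, hWaff, hzW, -⟩ := exists_isAffineOpen_mem_and_subset (X := Y)
    (x := pullback.fst q (specOfAlgebra k K) z) (U := ⊤) trivial
  let iW : Spec Γ(Y, W) ⟶ Y := hWaff.fromSpec
  let φ : CommRingCat.of k ⟶ Γ(Y, W) := (Scheme.ΓSpecIso (.of k)).inv ≫ q.appLE ⊤ W le_top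
  letI : Algebra k Γ(Y, W) := φ.hom.toAlgebra
  have hi : iW ≫ q = Spec.map (CommRingCat.ofHom (algebraMap k Γ(Y, W))) := by
    rw [RingHom.algebraMap_toAlgebra, CommRingCat.ofHom_hom, Spec.map_comp,
      ← Scheme.isoSpec_Spec_inv, ← IsAffineOpen.fromSpec_top,
      IsAffineOpen.SpecMap_appLE_fromSpec q (isAffineOpen_top _) hWaff]
  -- `z` lies in the chart `Spec (Γ(Y, W) ⊗ₖ K)`
  have hz : z ∈ Set.range (specTensorChart K q iW hi) := by
    rw [range_specTensorChart, Set.mem_preimage, IsAffineOpen.range_fromSpec]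
    exact hzW
  obtain ⟨ζ, rfl⟩ := hz
  rw [isRegularLocalRing_stalk_iff_of_isOpenImmersion (specTensorChart K q iW hi) ζ,
    isRegularLocalRing_stalk_Spec_iff]
  -- the point of `W` under `ζ` and its local ring as a localisation of `Γ(Y, W)`
  let 𝔭ζ : PrimeSpectrum Γ(Y, W) :=
    ⟨ζ.asIdeal.comap (algebraMap Γ(Y, W) (Γ(Y, W) ⊗[k] K)), Ideal.IsPrime.comap _⟩
  have hyζ : hWaff.fromSpec 𝔭ζ ∈ W := by
    rw [← SetLike.mem_coe, ← hWaff.range_fromSpec]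
    exact ⟨𝔭ζ, rfl⟩
  letI : Algebra Γ(Y, W) (Y.presheaf.stalk (hWaff.fromSpec 𝔭ζ)) :=
    TopCat.Presheaf.algebra_section_stalk Y.presheaf ⟨hWaff.fromSpec 𝔭ζ, hyζ⟩
  letI : Algebra k (Y.presheaf.stalk (hWaff.fromSpec 𝔭ζ)) :=
    ((algebraMap Γ(Y, W) (Y.presheaf.stalk (hWaff.fromSpec 𝔭ζ))).comp
      (algebraMap k Γ(Y, W))).toAlgebra
  haveI : IsScalarTower k Γ(Y, W) (Y.presheaf.stalk (hWaff.fromSpec 𝔭ζ)) :=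
    IsScalarTower.of_algebraMap_eq (fun _ => rfl)
  haveI : IsLocalization.AtPrime (Y.presheaf.stalk (hWaff.fromSpec 𝔭ζ)) 𝔭ζ.asIdeal :=
    hWaff.isLocalization_stalk' 𝔭ζ hyζ
  haveI : IsRegularLocalRing (Y.presheaf.stalk (hWaff.fromSpec 𝔭ζ)) := hY _
  have ha_stalk : algebraMap k (Y.presheaf.stalk (hWaff.fromSpec 𝔭ζ)) a =
      (Y.presheaf.germ ⊤ (hWaff.fromSpec 𝔭ζ) trivial).hom
        (q.appTop.hom ((Scheme.ΓSpecIso (.of k)).inv.hom a)) := by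
    change (Y.presheaf.germ W (hWaff.fromSpec 𝔭ζ) hyζ).hom ((q.appLE ⊤ W le_top).hom
      ((Scheme.ΓSpecIso (.of k)).inv.hom a)) = _
    rw [Scheme.Hom.appLE, CommRingCat.comp_apply,
      ← CommRingCat.comp_apply _ (Y.presheaf.germ W (hWaff.fromSpec 𝔭ζ) hyζ),
      TopCat.Presheaf.germ_res]
    rfl
  refine (isRegularLocalRing_localization_baseChange_iff ha hα hgen 𝔭ζ.asIdeal
    (Y.presheaf.stalk (hWaff.fromSpec 𝔭ζ)) ζ.asIdeal rfl).mpr fun c => ?_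
  rw [ha_stalk]
  exact hun _ c

/-- In particular (the unwounded case always available): if `a` is NOT a `p`-th power in any
residue field of `Y` — e.g. `Y` is a variety over `k` all of whose points have residue fields in
which `a` stays a non-`p`-th power — then `Y ×ₖ K` is regular as soon as `Y` is (`a - c^p ∈ 𝔪_y²`
would force `a ≡ c^p` in `κ(y)`). [folklore] -/
theorem isRegular_pullback_of_forall_residue {a : k} {α : K} (ha : ∀ b : k, b ^ p ≠ a)
    (hα : α ^ p = algebraMap k K a) (hgen : IntermediateField.adjoin k {α} = ⊤)
    {Y : Scheme.{0}} (q : Y ⟶ Spec (.of k)) (hY : Scheme.IsRegular Y)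
    (hres : ∀ (y : Y) (c : Y.presheaf.stalk y),
      (Y.presheaf.germ ⊤ y trivial).hom (q.appTop.hom ((Scheme.ΓSpecIso (.of k)).inv.hom a)) -
        c ^ p ∉ maximalIdeal (Y.presheaf.stalk y)) :
    Scheme.IsRegular (pullback q (Spec.map (CommRingCat.ofHom (algebraMap k K)))) :=
  (isRegular_pullback_iff_forall_not_wound ha hα hgen q hY).mpr fun y c hc =>
    hres y c (Ideal.pow_le_self two_ne_zero hc)

end SchemeLevel

end Summit.ResolutionOfSingularities.ResolutionOfSingularities.Theorems.DescentPerfectToAll.Negative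

end
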